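import Summits.QuantumFields.BalabanUV.T4Continuum.Support.NE7SliceIterationStateFactsNL
import Summits.QuantumFields.BalabanUV.T4Continuum.Support.NE7SliceIterationStep
import Summits.QuantumFields.BalabanUV.T4Continuum.Support.NE7FrameDefectLipschitzRadius
import HarnessLib

/-!
# NE7SliceIterationStepNL — ONE STEP OF THE (S1) ITERATION ON THE NONLINEAR FRAME TARGET, IN STATE FORM (memo ROAD-G103 §3, (R1′), file (B2)-3): `NE7SliceIterationStep` VERBATIM under `h ↦ h̃`,
# `ζ ↦ ζ̃`, with the EFFECTIVE corner junk `j̃_c := h̃(u¹) − (h̃(u) − ζ̃(u)(M•·)) = j_c + (P(u) − P(u¹))` sized by `ẽ_c := 4096ση + 4C_Γ·M²·b₁·(δ + e_J)` ((LP′) of `NE7FrameDefectLipschitzRadius` at the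
# orbit's regime radius `b₁`): `D̃f(e^{−ζ̃(u)}u) ≤ (e_E + s_E) + (frameC·M·e_E + ẽ_c)∕M`

Cell `pub-balaban`, rung (B)+1 sub-cell t4, lineage `b2b-balaban-t4-ne7-p1`, generation 103 (CRUX PROVER NE7 #1 = OWNER of BINDER row NE7).  Memo `t4/b2b-balaban-t4-ne7-p1-g103/ROAD-G103.md` §3.
The one-step identities `NE7SliceStepIdentities.phi_sub_phi_succ` ∕ `datum_succ` are applied with the effective corner logs `h̃ = h − P` and the effective junk `j̃_c` (the nonlinear target changes no
identity, only the corner-junk letter); the sized split is `NE7SliceStepOneStep.one_step_split_sized` with `e_c ↦ ẽ_c`; uniqueness `NE7SliceSplitUnique.slice_split_unique`.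
WHAT ([folklore]; 0 def, 0 sorry).  §1 `norm_repLog_le_radius`, `norm_gaugeDir_le_sliceDefectNL`, `sliceStepNL_unitary`, `sliceStepNL_periodic`, **`sliceStepNL_chart`**, **`sliceStepNL_corner`**, `norm_bondJunkNL_le`,
`norm_cornerJunkNL_le`, **`norm_repLog_sliceStepNL_le`**, **`norm_cornerLog_sliceStepNL_le`**, `norm_expUnit_neg_mul_sub_le`, **`norm_frameDefect_sliceStepNL_sub_le`** (`‖P(u¹) − P(u)‖ ≤ 4C_ΓM²b₁(δ + e_J)`),
**`norm_effCornerJunk_le`** (`‖j̃_c‖ ≤ ẽ_c`).  §2 **`sliceDefectNL_sliceStepNL_le`** (statement displayed).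
HONEST FRAMING (page 1): plumbing over landed theorems, (L) and B7's Prop-4 regime (level `k+1`, `W` and `U′`, ONE radius `b₁`) displayed; nothing of Bałaban's asserted; NOT the orbit, NOT (S1), NOT NE7;
spine 0∕9; finite T⁴ rung (B)+1 — NOT infinite volume, NOT mass gap, NOT BetaPertH, NOT Clay (continuum YM on T⁴ ⇐ BetaPertH ∧ nine spine estimates, 0/9 proved).
-/

set_option autoImplicit false

open scoped BigOperators Matrix.Norms.L2Operator
open NormedSpace Finset

namespace Summit.QuantumFields.BalabanUV.T4Continuum.NE7SliceIterationStepNL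

open Literature.MathematicalPhysics.QuantumFieldTheory.Balaban1983to89
open B7Prop1Explicit B7Prop2Explicit B7Prop3Flat MatrixLog
open T4AveragingDeficitWall (IsUnitaryCfg IsSkewDir SmallField vary curlAt)
open T4AveragingDeficitWallBoundary (IsPeriodicCfg periodBox)
open AveragingDeficitPeriodicCounting (IsPeriodicDir)
open AveragingDeficitTwoLevelPrep (prop1Radius)
open AveragingDeficitMultiLevelPrep (cavgIter LevelSmall tower cavgIter_unitary_small)
open BlockAveragePushDirGauge (gaugeDir isPeriodicDir_gaugeDir)
open BlockAverageLogInteraction (norm_exp_sub_one_le_two_mul)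
open BlockAverageCurrent (smallField_gaugeAct)
open NE3EnergyShapes (IsUnitarySite IsPeriodicSite)
open NE3TangentCovariantTower (dirIter framePotW)
open NE3CovariantBlockMean (bmeanIterW)
open NE3RightInverseSupLetters (frameC supC)
open NE3HatInvCurlLetters (supCurlC)
open NE3QbarIterCovLiftPrep (cruxC)
open NE3SmoothRightInverseW (rightInvW)
open NE3FramePotBoundW (tower_eq_pow_mul)
open NE3LandauOrbit (gaugeDir_skew)
open NE3LinearisedAverageSup (curvSum)
open NE7MeanZeroGaugeSliceW (energyBlockLandauW)
open NE7SliceSplitUnique (slice_split_unique)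
open NE7SliceStepIdentities (step_rep exp_corner_succ phi_sub_phi_succ tangent_succ datum_succ)
open NE7SliceStepErrorSizes (sup_step_residue_le sup_corner_residue_le sup_curl_step_residue_le)
open NE7SliceStepOneStep (one_step_split_sized)
open NE7SliceIterationStep (norm_repLog_le_eighth norm_cornerLog_le_eighth)
open SpreadLift (loopRad)
open NE7SliceIterationState (repLog cornerLog IsNormalisedSplit siteSup_le bondSup_le)
open NE7SliceIterationStateFacts (repLog_skew repLog_periodic cornerLog_skew cornerLog_periodic)
open NE7SliceIterationStateNL
open NE7SliceIterationStateFactsNL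
open NE7FrameDefectLipschitzRadius (norm_frameDefect_sub_frameDefect_le_of_radius)

noncomputable section
variable {d : ℕ} {n : Type*} [Fintype n] [DecidableEq n]

section Step
variable [Nonempty n] {L : ℕ} (hL : 2 ≤ L) (k : ℕ) {W : Site d → Fin d → (Matrix n n ℂ)ˣ} {x : ℝ} (hWu : IsUnitaryCfg W) (hx : 0 ≤ x) (hs : LevelSmall d L k x)
  (hWx : SmallField W x) (N : ℕ) [NeZero N] (hθ : cruxC d L * (((L : ℝ) ^ (k + 1)) ^ 2 * x) < 1) (U' : Site d → Fin d → (Matrix n n ℂ)ˣ)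
  (hWP : IsPeriodicCfg W ((tower L N (k + 1) : ℕ) : ℤ)) (hU'u : IsUnitaryCfg U') (hU'P : IsPeriodicCfg U' ((tower L N (k + 1) : ℕ) : ℤ))
  {u : Site d → (Matrix n n ℂ)ˣ} (hu : IsUnitarySite u) (huP : IsPeriodicSite u ((tower L N (k + 1) : ℕ) : ℤ))
  (hgauge : gaugeAct u U' = vary W (repLog W U' u) 1)
  (hcorner : ∀ z, ((u (((L : ℤ) ^ (k + 1)) • z) : (Matrix n n ℂ)ˣ) : Matrix n n ℂ) = exp (cornerLog L k u z))
  {s η : ℝ} (hXs : ∀ y κ, ‖repLog W U' u y κ‖ ≤ s) (hs4 : s ≤ 1 / 10000) (hhs : ∀ z, ‖cornerLog L k u z‖ ≤ η) (hη2 : η ≤ 1 / 100)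
  {δ σ : ℝ} (hδ : ∀ y μ, ‖gaugeDir W (gaugeFunNL hL k hWu hx hs hWx N hθ U' u) y μ‖ ≤ δ) (hσ : ∀ y, ‖gaugeFunNL hL k hWu hx hs hWx N hθ U' u y‖ ≤ σ)
  (hσ4 : σ ≤ 1 / 10000) (hs0 : 0 ≤ s) (hδ0 : 0 ≤ δ) (hσ0 : 0 ≤ σ)
  -- B7's Prop-4 regime at level `k+1` for `W` and `U′` at ONE radius `b₁ ≥ 2(s + δ + e_J)`
  (hd : 1 ≤ d) {α₀ αP x' b₁ : ℝ} (hα : 0 < α₀) (hα3 : C0 d * α₀ ≤ 1 / 3) (hα4 : 4 * α₀ ≤ c2' d L) (h52 : pdev W < α₀ * (((L : ℝ) ^ (k + 1))⁻¹) ^ 2)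
  (hsb : 2 * (s + (δ + (16384 * δ * s + 2048 * σ * δ + 6 * σ * s))) ≤ b₁)
  (hsmall : Real.exp (4 * (800 * ((d : ℝ) + 1) ^ 2 * ((d : ℝ) + 4)) * α₀) * (1 + 8 * (131072 * ((d : ℝ) + 1) ^ 2) * ((L : ℝ) ^ (k + 1) * b₁)) ≤ 2)
  (hc₃ : 2 * ((L : ℝ) ^ (k + 1) * b₁) ≤ c3 d L) (h100 : 100 * ((d : ℝ) * L * ((L : ℝ) ^ (k + 1) * b₁)) ≤ 1)
  (hC16 : 16 * (131072 * ((d : ℝ) + 1) ^ 2) * ((L : ℝ) ^ (k + 1) * b₁) ≤ 1) (hsm : 2048 * (d : ℝ) * ((L : ℝ) ^ (k + 1) * b₁) ≤ 1)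
  (hαP : 0 < αP) (hαP3 : C0 d * αP ≤ 1 / 3) (hαP2 : 2 * αP ≤ c2' d L) (hx' : 0 ≤ x') (hU'x : SmallField U' x') (hx'P : x' < αP * (((L : ℝ) ^ (k + 1))⁻¹) ^ 2)

/-! ## §1 The next state: unitary, periodic, chart, corners, sizes, displacement, the frame defect's move -/
omit [Nonempty n] [NeZero N] in
include hXs hsb hs0 hδ0 hσ0 in
/-- size bookkeeping: `‖X(u)‖ ≤ b₁`. [folklore] -/
theorem norm_repLog_le_radius (y : Site d) (κ : Fin d) : ‖repLog W U' u y κ‖ ≤ b₁ := by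
  have heJ0 : 0 ≤ 16384 * δ * s + 2048 * σ * δ + 6 * σ * s := by positivity
  exact (hXs y κ).trans (by linarith only [hsb, heJ0, hs0, hδ0])

omit [Nonempty n] [NeZero N] in
include hsb hs0 hδ0 hσ0 in
/-- `0 ≤ b₁`. [folklore] -/
theorem radius_nonneg : 0 ≤ b₁ := by
  have heJ0 : 0 ≤ 16384 * δ * s + 2048 * σ * δ + 6 * σ * s := by positivity
  linarith only [hsb, heJ0, hs0, hδ0]

include hWP hU'u hU'P hu huP hgauge hcorner hXs hs4 hhs hη2 hs0 hδ0 hσ0 hd hα hα3 hα4 h52 hsb hsmall hc₃ hsm hαP hαP3 hαP2 hx' hU'x hx'P in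
/-- **`‖gaugeDir W ζ̃(u)‖ ≤ D̃f(u)`** everywhere on the working region. [folklore] -/
theorem norm_gaugeDir_le_sliceDefectNL (y : Site d) (μ : Fin d) :
    ‖gaugeDir W (gaugeFunNL hL k hWu hx hs hWx N hθ U' u) y μ‖ ≤ sliceDefectNL hL k hWu hx hs hWx N hθ U' u :=
  (norm_gaugeDir_gaugeFunNL_le hL k hWu hx hs hWx N hθ U' hWP hU'u hU'P hu huP hgauge (norm_repLog_le_eighth U' hXs hs4) hcorner (norm_cornerLog_le_eighth k hhs hη2)
    hd hα hα3 hα4 h52 (radius_nonneg hs0 hδ0 hσ0 hsb) (norm_repLog_le_radius U' hXs hs0 hδ0 hσ0 hsb) hsmall hc₃ hsm hαP hαP3 hαP2 hx' hU'x hx'P y μ).trans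
    (delta_le_sliceDefectNL hL k hWu hx hs hWx N hθ U' u)

include hWP hU'u hU'P hu huP hgauge hcorner hXs hs4 hhs hη2 hs0 hδ0 hσ0 hd hα hα3 hα4 h52 hsb hsmall hc₃ hsm hαP hαP3 hαP2 hx' hU'x hx'P in
/-- **`u¹` IS UNITARY** (`ζ̃(u)` is skew). [folklore] -/
theorem sliceStepNL_unitary : IsUnitarySite (sliceStepNL hL k hWu hx hs hWx N hθ U' u) := by
  have hζs := (splitNL_holds hL k hWu hx hs hWx N hθ U' hWP hU'u hU'P hu huP hgauge (norm_repLog_le_eighth U' hXs hs4) hcorner (norm_cornerLog_le_eighth k hhs hη2)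
    hd hα hα3 hα4 h52 (radius_nonneg hs0 hδ0 hσ0 hsb) (norm_repLog_le_radius U' hXs hs0 hδ0 hσ0 hsb) hsmall hc₃ hsm hαP hαP3 hαP2 hx' hU'x hx'P).1
  intro y
  rw [sliceStepNL_apply]
  refine (unitaryUnits _).mul_mem ?_ (hu y)
  rw [mem_unitaryUnits, val_expUnit]
  letI : NormedAlgebra ℚ (Matrix n n ℂ) := NormedAlgebra.restrictScalars ℚ ℂ (Matrix n n ℂ)
  exact NormedSpace.exp_mem_unitary_of_mem_skewAdjoint ((skewAdjoint _).neg_mem (hζs y))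

include hWP hU'u hU'P hu huP hgauge hcorner hXs hs4 hhs hη2 hs0 hδ0 hσ0 hd hα hα3 hα4 h52 hsb hsmall hc₃ hsm hαP hαP3 hαP2 hx' hU'x hx'P in
/-- **`u¹` IS `(tower)`-PERIODIC**. [folklore] -/
theorem sliceStepNL_periodic : IsPeriodicSite (sliceStepNL hL k hWu hx hs hWx N hθ U' u) ((tower L N (k + 1) : ℕ) : ℤ) := by
  have hζP := (splitNL_holds hL k hWu hx hs hWx N hθ U' hWP hU'u hU'P hu huP hgauge (norm_repLog_le_eighth U' hXs hs4) hcorner (norm_cornerLog_le_eighth k hhs hη2)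
    hd hα hα3 hα4 h52 (radius_nonneg hs0 hδ0 hσ0 hsb) (norm_repLog_le_radius U' hXs hs0 hδ0 hσ0 hsb) hsmall hc₃ hsm hαP hαP3 hαP2 hx' hU'x hx'P).2.1
  intro y i
  rw [sliceStepNL_apply, sliceStepNL_apply, hζP y i, huP y i]

include hgauge hXs hs4 hσ hσ4 in
/-- **THE CHART CONDITION PROPAGATES**: `U′^{u¹} = W·e^{X(u¹)}`. [folklore] -/
theorem sliceStepNL_chart : gaugeAct (sliceStepNL hL k hWu hx hs hWx N hθ U' u) U' = vary W (repLog W U' (sliceStepNL hL k hWu hx hs hWx N hθ U' u)) 1 :=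
  step_rep hWu hgauge (fun y => (hσ y).trans hσ4) (fun y κ => (hXs y κ).trans hs4)

include hcorner hhs hη2 hσ hσ4 in
/-- **THE CORNER CONDITION PROPAGATES**: `u¹(M•z) = e^{h(u¹) z}`. [folklore] -/
theorem sliceStepNL_corner (z : Site d) :
    ((sliceStepNL hL k hWu hx hs hWx N hθ U' u (((L : ℤ) ^ (k + 1)) • z) : (Matrix n n ℂ)ˣ) : Matrix n n ℂ)
      = exp (cornerLog L k (sliceStepNL hL k hWu hx hs hWx N hθ U' u) z) :=
  (exp_corner_succ (hcorner z) ((hσ _).trans (hσ4.trans (by norm_num))) ((hhs z).trans hη2)).symm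

include hgauge hXs hs4 hδ hσ hσ4 in
/-- **THE BOND JUNK** `J := X(u¹) − (X(u) − gaugeDir W ζ̃(u))`: `‖J‖ ≤ e_J := 16384·δ·s + 2048·σ·δ + 6σs`. [folklore] -/
theorem norm_bondJunkNL_le (y : Site d) (κ : Fin d) :
    ‖repLog W U' (sliceStepNL hL k hWu hx hs hWx N hθ U' u) y κ - (repLog W U' u y κ - gaugeDir W (gaugeFunNL hL k hWu hx hs hWx N hθ U' u) y κ)‖
      ≤ 16384 * δ * s + 2048 * σ * δ + 6 * σ * s :=
  sup_step_residue_le hWu hgauge (u := u) hσ hσ4 hXs hs4 hδ y κ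

include hcorner hhs hη2 hσ hσ4 in
/-- **THE RAW CORNER JUNK** `j_c := h(u¹) − (h(u) − ζ̃(u)(M•·))`: `‖j_c‖ ≤ 4096·σ·η`. [folklore] -/
theorem norm_cornerJunkNL_le (z : Site d) :
    ‖cornerLog L k (sliceStepNL hL k hWu hx hs hWx N hθ U' u) z - (cornerLog L k u z - gaugeFunNL hL k hWu hx hs hWx N hθ U' u (((L : ℤ) ^ (k + 1)) • z))‖
      ≤ 4096 * σ * η :=
  sup_corner_residue_le (hcorner z) (hσ (((L : ℤ) ^ (k + 1)) • z)) (hσ4.trans (by norm_num)) (hhs z) hη2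

include hgauge hXs hs4 hδ hσ hσ4 in
/-- **THE SIZE OF `X(u¹)`**: `‖X(u¹)‖ ≤ s + δ + e_J`. [folklore] -/
theorem norm_repLog_sliceStepNL_le (y : Site d) (κ : Fin d) :
    ‖repLog W U' (sliceStepNL hL k hWu hx hs hWx N hθ U' u) y κ‖ ≤ s + δ + (16384 * δ * s + 2048 * σ * δ + 6 * σ * s) := by
  have hJ := norm_bondJunkNL_le hL k hWu hx hs hWx N hθ U' hgauge hXs hs4 hδ hσ hσ4 y κ
  have e : repLog W U' (sliceStepNL hL k hWu hx hs hWx N hθ U' u) y κ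
      = (repLog W U' (sliceStepNL hL k hWu hx hs hWx N hθ U' u) y κ - (repLog W U' u y κ - gaugeDir W (gaugeFunNL hL k hWu hx hs hWx N hθ U' u) y κ))
        + (repLog W U' u y κ - gaugeDir W (gaugeFunNL hL k hWu hx hs hWx N hθ U' u) y κ) := by abel
  rw [e]
  refine (norm_add_le _ _).trans ?_
  have h2 := norm_sub_le (repLog W U' u y κ) (gaugeDir W (gaugeFunNL hL k hWu hx hs hWx N hθ U' u) y κ)
  linarith only [hJ, h2, hXs y κ, hδ y κ]

include hgauge hXs hs4 hδ hσ hσ4 in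
/-- **THE STEP OF `X`**: `‖X(u¹) − X(u)‖ ≤ δ + e_J`. [folklore] -/
theorem norm_repLog_sliceStepNL_sub_le (y : Site d) (κ : Fin d) :
    ‖repLog W U' (sliceStepNL hL k hWu hx hs hWx N hθ U' u) y κ - repLog W U' u y κ‖ ≤ δ + (16384 * δ * s + 2048 * σ * δ + 6 * σ * s) := by
  have hJ := norm_bondJunkNL_le hL k hWu hx hs hWx N hθ U' hgauge hXs hs4 hδ hσ hσ4 y κ
  have e : repLog W U' (sliceStepNL hL k hWu hx hs hWx N hθ U' u) y κ - repLog W U' u y κ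
      = (repLog W U' (sliceStepNL hL k hWu hx hs hWx N hθ U' u) y κ - (repLog W U' u y κ - gaugeDir W (gaugeFunNL hL k hWu hx hs hWx N hθ U' u) y κ))
        - gaugeDir W (gaugeFunNL hL k hWu hx hs hWx N hθ U' u) y κ := by abel
  rw [e]
  exact (norm_sub_le _ _).trans (by linarith only [hJ, hδ y κ])

include hcorner hhs hη2 hσ hσ4 in
/-- **THE SIZE OF `h(u¹)`**: `‖h(u¹) z‖ ≤ η + σ + 4096·σ·η`. [folklore] -/
theorem norm_cornerLog_sliceStepNL_le (z : Site d) :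
    ‖cornerLog L k (sliceStepNL hL k hWu hx hs hWx N hθ U' u) z‖ ≤ η + σ + 4096 * σ * η := by
  have hjc := norm_cornerJunkNL_le hL k hWu hx hs hWx N hθ U' hcorner hhs hη2 hσ hσ4 z
  have e : cornerLog L k (sliceStepNL hL k hWu hx hs hWx N hθ U' u) z
      = (cornerLog L k (sliceStepNL hL k hWu hx hs hWx N hθ U' u) z - (cornerLog L k u z - gaugeFunNL hL k hWu hx hs hWx N hθ U' u (((L : ℤ) ^ (k + 1)) • z)))
        + (cornerLog L k u z - gaugeFunNL hL k hWu hx hs hWx N hθ U' u (((L : ℤ) ^ (k + 1)) • z)) := by abel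
  rw [e]
  refine (norm_add_le _ _).trans ?_
  have h2 := norm_sub_le (cornerLog L k u z) (gaugeFunNL hL k hWu hx hs hWx N hθ U' u (((L : ℤ) ^ (k + 1)) • z))
  linarith only [hjc, h2, hhs z, hσ (((L : ℤ) ^ (k + 1)) • z)]

omit [NeZero N] in
/-- **THE DISPLACEMENT OF A GAUGE STEP AT ONE SITE**: for a unitary `v` and `‖ζ‖ ≤ σ ≤ 10⁻⁴`, `‖e^{−ζ}·v − v‖ ≤ 2σ` (so `‖u¹(y) − u(y)‖ ≤ 2σ` for `u¹ = e^{−ζ̃(u)}u`, `sliceStepNL_apply`). [folklore] -/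
theorem norm_expUnit_neg_mul_sub_le {v : (Matrix n n ℂ)ˣ} (hv : v ∈ unitaryUnits (Matrix n n ℂ)) {ζ : Matrix n n ℂ} {σ' : ℝ} (hζ : ‖ζ‖ ≤ σ') (hσ' : σ' ≤ 1 / 10000) :
    ‖((expUnit (-ζ) * v : (Matrix n n ℂ)ˣ) : Matrix n n ℂ) - ((v : (Matrix n n ℂ)ˣ) : Matrix n n ℂ)‖ ≤ 2 * σ' := by
  have hu1 : ‖((v : (Matrix n n ℂ)ˣ) : Matrix n n ℂ)‖ = 1 := CStarRing.norm_of_mem_unitary (mem_unitaryUnits.mp hv)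
  have e : ((expUnit (-ζ) * v : (Matrix n n ℂ)ˣ) : Matrix n n ℂ) - ((v : (Matrix n n ℂ)ˣ) : Matrix n n ℂ)
      = (exp (-ζ) - 1) * ((v : (Matrix n n ℂ)ˣ) : Matrix n n ℂ) := by
    rw [Units.val_mul, val_expUnit, sub_mul, one_mul]
  rw [e]
  refine (norm_mul_le _ _).trans ?_
  rw [hu1, mul_one]
  exact (norm_exp_sub_one_le_two_mul (by rw [norm_neg]; exact hζ) (hσ'.trans (by norm_num))).1

include hgauge hXs hs4 hδ hσ hσ4 hs0 hδ0 hσ0 hα hα3 hα4 h52 hsb hsmall hc₃ h100 hC16 hsm in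
/-- **THE FRAME DEFECT MOVES BY A MULTIPLE `O(M·b₁)` OF THE STEP**: `‖P(u¹)(z) − P(u)(z)‖ ≤ 4C_Γ·(L^{k+1})²·b₁·(δ + e_J)` ((LP′) with `sup‖X(u)‖ ≤ s`, `sup‖X(u¹) − X(u)‖ ≤ δ + e_J`,
`2(s + δ + e_J) ≤ b₁`). [folklore] -/
theorem norm_frameDefect_sliceStepNL_sub_le (κ₀ : Fin d) (z : Site d) :
    ‖frameDefect L k W U' (sliceStepNL hL k hWu hx hs hWx N hθ U' u) z - frameDefect L k W U' u z‖
      ≤ 4 * (56 * ((d : ℝ) * L) ^ 2 + 16 * (131072 * ((d : ℝ) + 1) ^ 2) * ((d : ℝ) * L)) * ((L : ℝ) ^ (k + 1)) ^ 2 * b₁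
        * (δ + (16384 * δ * s + 2048 * σ * δ + 6 * σ * s)) := by
  have heJ0 : 0 ≤ 16384 * δ * s + 2048 * σ * δ + 6 * σ * s := by positivity
  exact norm_frameDefect_sub_frameDefect_le_of_radius hL k hWu hα hα3 hα4 h52 κ₀ hx hs hWx hs0 (by positivity) hXs
    (norm_repLog_sliceStepNL_sub_le hL k hWu hx hs hWx N hθ U' hgauge hXs hs4 hδ hσ hσ4) hsb hsmall hc₃ h100 hC16 hsm z

include hgauge hcorner hXs hs4 hhs hη2 hδ hσ hσ4 hs0 hδ0 hσ0 hα hα3 hα4 h52 hsb hsmall hc₃ h100 hC16 hsm in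
/-- **THE EFFECTIVE CORNER JUNK** `j̃_c := h̃(u¹) − (h̃(u) − ζ̃(u)(M•·)) = j_c − (P(u¹) − P(u))`: `‖j̃_c‖ ≤ ẽ_c := 4096ση + 4C_Γ(L^{k+1})²b₁(δ + e_J)`. [folklore] -/
theorem norm_effCornerJunk_le (κ₀ : Fin d) (z : Site d) :
    ‖effCornerLog L k W U' (sliceStepNL hL k hWu hx hs hWx N hθ U' u) z - (effCornerLog L k W U' u z - gaugeFunNL hL k hWu hx hs hWx N hθ U' u (((L : ℤ) ^ (k + 1)) • z))‖
      ≤ 4096 * σ * η + 4 * (56 * ((d : ℝ) * L) ^ 2 + 16 * (131072 * ((d : ℝ) + 1) ^ 2) * ((d : ℝ) * L)) * ((L : ℝ) ^ (k + 1)) ^ 2 * b₁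
        * (δ + (16384 * δ * s + 2048 * σ * δ + 6 * σ * s)) := by
  have hjc := norm_cornerJunkNL_le hL k hWu hx hs hWx N hθ U' hcorner hhs hη2 hσ hσ4 z
  have hP := norm_frameDefect_sliceStepNL_sub_le hL k hWu hx hs hWx N hθ U' hgauge hXs hs4 hδ hσ hσ4 hs0 hδ0 hσ0 hα hα3 hα4 h52 hsb hsmall hc₃ h100 hC16 hsm κ₀ z
  have e : effCornerLog L k W U' (sliceStepNL hL k hWu hx hs hWx N hθ U' u) z - (effCornerLog L k W U' u z - gaugeFunNL hL k hWu hx hs hWx N hθ U' u (((L : ℤ) ^ (k + 1)) • z))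
      = (cornerLog L k (sliceStepNL hL k hWu hx hs hWx N hθ U' u) z - (cornerLog L k u z - gaugeFunNL hL k hWu hx hs hWx N hθ U' u (((L : ℤ) ^ (k + 1)) • z)))
        - (frameDefect L k W U' (sliceStepNL hL k hWu hx hs hWx N hθ U' u) z - frameDefect L k W U' u z) := by
    simp only [effCornerLog]; abel
  rw [e]
  exact (norm_sub_le _ _).trans (add_le_add hjc hP)

/-! ## §2 The defect after the step -/
include hWP hU'u hU'P hu huP hgauge hcorner hXs hs4 hhs hη2 hδ hσ hσ4 hs0 hδ0 hσ0 hd hα hα3 hα4 h52 hsb hsmall hc₃ h100 hC16 hsm hαP hαP3 hαP2 hx' hU'x hx'P in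
/-- **THE DEFECT AFTER ONE STEP ON THE NONLINEAR TARGET** — `NE7SliceIterationStep.sliceDefect_sliceStep_le` with the corner-junk letter `e_c = 4096ση` replaced by
`ẽ_c := 4096ση + 4C_Γ(L^{k+1})²b₁(δ + e_J)`: under the same hypotheses (class at level `k+1`, `d ≥ 1`, `L ≥ 2`, (L) displayed as `hLet` with `K ≥ 0`, `16Kd·M²x ≤ 1∕2`, `θ_P ≤ 1∕2`, `M²x ≤ 1`,
`curvSum ≤ 2L∕3`, state on the working region with `‖X(u)‖ ≤ s ≤ 10⁻⁴`, `‖h(u)‖ ≤ η ≤ 10⁻²`, `‖gaugeDir W ζ̃(u)‖ ≤ δ ≤ 10⁻⁴`, `‖ζ̃(u)‖ ≤ σ ≤ 10⁻⁴`) PLUS B7's Prop-4 regime for `W` and `U′` at the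
radius `b₁ ≥ 2(s + δ + e_J)`, and ANY `e_E ≥ e_J + supC∕(M(1−θ))·ẽ_φ`, `c_E ≥ c_J + supCurlC∕(M²(1−θ))·ẽ_φ` (`ẽ_φ := (3+12d)M·e_J + 2ẽ_c`):
`D̃f(e^{−ζ̃(u)}u) ≤ (e_E + s_E) + (frameC·M·e_E + ẽ_c)∕M`, `s_E := 2KM·c_E + 8K(M²x)(frameC·M·e_E + ẽ_c)∕M + 16Kd(M²x)·e_E`. [folklore] -/
theorem sliceDefectNL_sliceStepNL_le (κ₀ : Fin d)
    (hθP : 4 * (d : ℝ) ^ 2 * ((L : ℝ) ^ (k + 1) - 1) ^ 2 * x + 16 * d * loopRad d L ((prop1Radius d L)^[k] x)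
      + 4 * d * ((d : ℝ) - 1) * ((L : ℝ) ^ (k + 1) - 1) ^ 2 * x ≤ 1 / 2)
    {K : ℝ} (hK : 0 ≤ K) (hKε : 16 * K * d * (((L : ℝ) ^ (k + 1)) ^ 2 * x) ≤ 1 / 2)
    (hLet : ∀ Y : Site d → Fin d → Matrix n n ℂ, Y ∈ energyBlockLandauW (d := d) (n := n) L N (k + 1) W →
      ∀ B : ℝ, (∀ (z : Site d) (μ ν : Fin d), μ ≠ ν → ‖curlAt W Y z μ ν‖ ≤ B) → ∀ (y : Site d) (κ : Fin d), ‖Y y κ‖ ≤ K * (L : ℝ) ^ (k + 1) * B)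
    (hε : ((L : ℝ) ^ (k + 1)) ^ 2 * x ≤ 1) (hA : curvSum d L (k + 1) x ≤ 2 / 3 * L)
    (hη0 : 0 ≤ η) (hδ4 : δ ≤ 1 / 10000)
    {eE cE : ℝ} (heE0 : 0 ≤ eE) (hcE0 : 0 ≤ cE)
    (heE : (16384 * δ * s + 2048 * σ * δ + 6 * σ * s)
      + supC d L / ((L : ℝ) ^ (k + 1) * (1 - cruxC d L * (((L : ℝ) ^ (k + 1)) ^ 2 * x)))
        * ((3 + 12 * (d : ℝ)) * (L : ℝ) ^ (k + 1) * (16384 * δ * s + 2048 * σ * δ + 6 * σ * s) + 2 * (4096 * σ * η + 4 * (56 * ((d : ℝ) * L) ^ 2 + 16 * (131072 * ((d : ℝ) + 1) ^ 2) * ((d : ℝ) * L)) * ((L : ℝ) ^ (k + 1)) ^ 2 * b₁ * (δ + (16384 * δ * s + 2048 * σ * δ + 6 * σ * s)))) ≤ eE)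
    (hcE : (2 * (2 * σ) * x' + 4 * (Real.exp (4 * (s + δ + (16384 * δ * s + 2048 * σ * δ + 6 * σ * s))) - 1) * (δ + (16384 * δ * s + 2048 * σ * δ + 6 * σ * s)) + 2 * x * σ)
      + supCurlC d L / (((L : ℝ) ^ (k + 1)) ^ 2 * (1 - cruxC d L * (((L : ℝ) ^ (k + 1)) ^ 2 * x)))
        * ((3 + 12 * (d : ℝ)) * (L : ℝ) ^ (k + 1) * (16384 * δ * s + 2048 * σ * δ + 6 * σ * s) + 2 * (4096 * σ * η + 4 * (56 * ((d : ℝ) * L) ^ 2 + 16 * (131072 * ((d : ℝ) + 1) ^ 2) * ((d : ℝ) * L)) * ((L : ℝ) ^ (k + 1)) ^ 2 * b₁ * (δ + (16384 * δ * s + 2048 * σ * δ + 6 * σ * s)))) ≤ cE) :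
    sliceDefectNL hL k hWu hx hs hWx N hθ U' (sliceStepNL hL k hWu hx hs hWx N hθ U' u)
      ≤ (eE + (2 * K * (L : ℝ) ^ (k + 1) * cE + 8 * K * (((L : ℝ) ^ (k + 1)) ^ 2 * x) * (frameC d L * (L : ℝ) ^ (k + 1) * eE + (4096 * σ * η + 4 * (56 * ((d : ℝ) * L) ^ 2 + 16 * (131072 * ((d : ℝ) + 1) ^ 2) * ((d : ℝ) * L)) * ((L : ℝ) ^ (k + 1)) ^ 2 * b₁ * (δ + (16384 * δ * s + 2048 * σ * δ + 6 * σ * s)))) / (L : ℝ) ^ (k + 1)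
          + 16 * K * d * (((L : ℝ) ^ (k + 1)) ^ 2 * x) * eE))
        + (frameC d L * (L : ℝ) ^ (k + 1) * eE + (4096 * σ * η + 4 * (56 * ((d : ℝ) * L) ^ 2 + 16 * (131072 * ((d : ℝ) + 1) ^ 2) * ((d : ℝ) * L)) * ((L : ℝ) ^ (k + 1)) ^ 2 * b₁ * (δ + (16384 * δ * s + 2048 * σ * δ + 6 * σ * s)))) / (L : ℝ) ^ (k + 1) := by
  haveI : NeZero L := ⟨by omega⟩
  have hL1 : 1 ≤ L := by omega
  have hd0 : 0 < d := hd
  have hM : 0 < (L : ℝ) ^ (k + 1) := pow_pos (by exact_mod_cast (by omega : 0 < L)) _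
  have hP1 : 1 ≤ tower L N (k + 1) := Nat.one_le_iff_ne_zero.mpr (NeZero.ne _)
  have hN1 : 1 ≤ N := Nat.one_le_iff_ne_zero.mpr (NeZero.ne _)
  have heJ0 : 0 ≤ (16384 * δ * s + 2048 * σ * δ + 6 * σ * s) := by positivity
  have hb₁0 : 0 ≤ b₁ := radius_nonneg hs0 hδ0 hσ0 hsb
  have hCΓ0 : 0 ≤ 4 * (56 * ((d : ℝ) * L) ^ 2 + 16 * (131072 * ((d : ℝ) + 1) ^ 2) * ((d : ℝ) * L)) * ((L : ℝ) ^ (k + 1)) ^ 2 * b₁ := by positivity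
  have hec0 : 0 ≤ (4096 * σ * η + 4 * (56 * ((d : ℝ) * L) ^ 2 + 16 * (131072 * ((d : ℝ) + 1) ^ 2) * ((d : ℝ) * L)) * ((L : ℝ) ^ (k + 1)) ^ 2 * b₁ * (δ + (16384 * δ * s + 2048 * σ * δ + 6 * σ * s))) := by positivity
  -- state-0 facts
  have hX8 := norm_repLog_le_eighth U' hXs hs4
  have hh8 := norm_cornerLog_le_eighth k hhs hη2
  have hXb0 := norm_repLog_le_radius U' hXs hs0 hδ0 hσ0 hsb
  obtain ⟨hζs, hζP, hY0, hsplit0, hmean0⟩ := splitNL_holds hL k hWu hx hs hWx N hθ U' hWP hU'u hU'P hu huP hgauge hX8 hcorner hh8 hd hα hα3 hα4 h52 hb₁0 hXb0 hsmall hc₃ hsm hαP hαP3 hαP2 hx' hU'x hx'P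
  have hφ0 := coarseDatumNL_skew_periodic hL k hWu hx hs hWx N U' hWP hU'u hU'P hu huP hgauge hX8 hcorner hh8 hd hα hα3 hα4 h52 hb₁0 hXb0 hsmall hc₃ hsm hαP hαP3 hαP2 hx' hU'x hx'P
  -- the next state, made opaque, and its facts
  obtain ⟨u1, hu1def⟩ : ∃ v : Site d → (Matrix n n ℂ)ˣ, v = sliceStepNL hL k hWu hx hs hWx N hθ U' u := ⟨_, rfl⟩
  rw [← hu1def]
  have hu1 : IsUnitarySite u1 := by
    rw [hu1def]; exact sliceStepNL_unitary hL k hWu hx hs hWx N hθ U' hWP hU'u hU'P hu huP hgauge hcorner hXs hs4 hhs hη2 hs0 hδ0 hσ0 hd hα hα3 hα4 h52 hsb hsmall hc₃ hsm hαP hαP3 hαP2 hx' hU'x hx'P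
  have hu1P : IsPeriodicSite u1 ((tower L N (k + 1) : ℕ) : ℤ) := by
    rw [hu1def]; exact sliceStepNL_periodic hL k hWu hx hs hWx N hθ U' hWP hU'u hU'P hu huP hgauge hcorner hXs hs4 hhs hη2 hs0 hδ0 hσ0 hd hα hα3 hα4 h52 hsb hsmall hc₃ hsm hαP hαP3 hαP2 hx' hU'x hx'P
  have hgauge1 : gaugeAct u1 U' = vary W (repLog W U' u1) 1 := by
    rw [hu1def]; exact sliceStepNL_chart hL k hWu hx hs hWx N hθ U' hgauge hXs hs4 hσ hσ4
  have hcorner1 : ∀ z, ((u1 (((L : ℤ) ^ (k + 1)) • z) : (Matrix n n ℂ)ˣ) : Matrix n n ℂ) = exp (cornerLog L k u1 z) := by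
    rw [hu1def]; exact sliceStepNL_corner hL k hWu hx hs hWx N hθ U' hcorner hhs hη2 hσ hσ4
  have hJraw : ∀ y κ, ‖repLog W U' u1 y κ - (repLog W U' u y κ - gaugeDir W (gaugeFunNL hL k hWu hx hs hWx N hθ U' u) y κ)‖ ≤ (16384 * δ * s + 2048 * σ * δ + 6 * σ * s) := by
    rw [hu1def]; exact norm_bondJunkNL_le hL k hWu hx hs hWx N hθ U' hgauge hXs hs4 hδ hσ hσ4
  have hjcraw : ∀ z, ‖effCornerLog L k W U' u1 z - (effCornerLog L k W U' u z - gaugeFunNL hL k hWu hx hs hWx N hθ U' u (((L : ℤ) ^ (k + 1)) • z))‖ ≤ (4096 * σ * η + 4 * (56 * ((d : ℝ) * L) ^ 2 + 16 * (131072 * ((d : ℝ) + 1) ^ 2) * ((d : ℝ) * L)) * ((L : ℝ) ^ (k + 1)) ^ 2 * b₁ * (δ + (16384 * δ * s + 2048 * σ * δ + 6 * σ * s))) := by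
    rw [hu1def]; exact norm_effCornerJunk_le hL k hWu hx hs hWx N hθ U' hgauge hcorner hXs hs4 hhs hη2 hδ hσ hσ4 hs0 hδ0 hσ0 hα hα3 hα4 h52 hsb hsmall hc₃ h100 hC16 hsm κ₀
  have hX1 : ∀ y κ, ‖repLog W U' u1 y κ‖ ≤ s + δ + (16384 * δ * s + 2048 * σ * δ + 6 * σ * s) := by
    rw [hu1def]; exact norm_repLog_sliceStepNL_le hL k hWu hx hs hWx N hθ U' hgauge hXs hs4 hδ hσ hσ4
  have hh1 : ∀ z, ‖cornerLog L k u1 z‖ ≤ η + σ + 4096 * σ * η := by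
    rw [hu1def]; exact norm_cornerLog_sliceStepNL_le hL k hWu hx hs hWx N hθ U' hcorner hhs hη2 hσ hσ4
  have hp1 : δ * s ≤ 1 / 10000 * (1 / 10000) := mul_le_mul hδ4 hs4 hs0 (by norm_num)
  have hp2 : σ * δ ≤ 1 / 10000 * (1 / 10000) := mul_le_mul hσ4 hδ4 hδ0 (by norm_num)
  have hp3 : σ * s ≤ 1 / 10000 * (1 / 10000) := mul_le_mul hσ4 hs4 hs0 (by norm_num)
  have hp4 : σ * η ≤ 1 / 10000 * (1 / 100) := mul_le_mul hσ4 hη2 hη0 (by norm_num)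
  have heJs : (16384 * δ * s + 2048 * σ * δ + 6 * σ * s) ≤ 3 / 10000 := by
    have e1 : 16384 * δ * s = 16384 * (δ * s) := by ring
    have e2 : 2048 * σ * δ = 2048 * (σ * δ) := by ring
    have e3 : 6 * σ * s = 6 * (σ * s) := by ring
    rw [e1, e2, e3]; linarith only [hp1, hp2, hp3]
  have hX1_8 : ∀ y κ, ‖repLog W U' u1 y κ‖ ≤ 1 / 8 := fun y κ => (hX1 y κ).trans (by linarith only [hs4, hδ4, heJs])
  have hXb1 : ∀ y κ, ‖repLog W U' u1 y κ‖ ≤ b₁ := fun y κ => (hX1 y κ).trans (by linarith only [hsb, hs0, hδ0, heJ0])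
  have hecs : 4096 * σ * η ≤ 1 / 200 := by
    have e4 : 4096 * σ * η = 4096 * (σ * η) := by ring
    rw [e4]; linarith only [hp4]
  have hh1_8 : ∀ z, ‖cornerLog L k u1 z‖ ≤ 1 / 8 := fun z => (hh1 z).trans (by linarith only [hη2, hσ4, hecs])
  have hφ1 := coarseDatumNL_skew_periodic hL k hWu hx hs hWx N U' hWP hU'u hU'P hu1 hu1P hgauge1 hX1_8 hcorner1 hh1_8 hd hα hα3 hα4 h52 hb₁0 hXb1 hsmall hc₃ hsm hαP hαP3 hαP2 hx' hU'x hx'P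
  obtain ⟨hζ1s, hζ1P, hY1, hsplit1, hmean1⟩ := splitNL_holds hL k hWu hx hs hWx N hθ U' hWP hU'u hU'P hu1 hu1P hgauge1 hX1_8 hcorner1 hh1_8 hd hα hα3 hα4 h52 hb₁0 hXb1 hsmall hc₃ hsm hαP hαP3 hαP2 hx' hU'x hx'P
  -- the junk fields (the corner junk is the EFFECTIVE one)
  obtain ⟨J, hJdef⟩ : ∃ J : Site d → Fin d → Matrix n n ℂ, J = fun y κ =>
      repLog W U' u1 y κ - (repLog W U' u y κ - gaugeDir W (gaugeFunNL hL k hWu hx hs hWx N hθ U' u) y κ) := ⟨_, rfl⟩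
  obtain ⟨jc, hjcdef⟩ : ∃ jc : Site d → Matrix n n ℂ, jc = fun z =>
      effCornerLog L k W U' u1 z - (effCornerLog L k W U' u z - gaugeFunNL hL k hWu hx hs hWx N hθ U' u (((L : ℤ) ^ (k + 1)) • z)) := ⟨_, rfl⟩
  have hX1eq : ∀ y κ, repLog W U' u1 y κ = repLog W U' u y κ - gaugeDir W (gaugeFunNL hL k hWu hx hs hWx N hθ U' u) y κ + J y κ := fun y κ => by
    rw [hJdef, add_sub_cancel]
  have hh1eq : ∀ z, effCornerLog L k W U' u1 z = effCornerLog L k W U' u z - gaugeFunNL hL k hWu hx hs hWx N hθ U' u (((L : ℤ) ^ (k + 1)) • z) + jc z := fun z => by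
    rw [hjcdef, add_sub_cancel]
  -- the coarse datum moves by the junk; the datum of the next split is the effective corner junk
  have hdφ : ∀ z κ, coarseDatumNL L k W U' u z κ - coarseDatumNL L k W U' u1 z κ = -dirIter L (k + 1) W J z κ + gaugeDir (cavgIter L (k + 1) W) jc z κ :=
    fun z κ => phi_sub_phi_succ hL1 k hWu hWP hx hs hWx hζs hζP hX1eq hh1eq z κ
  have hdat : ∀ z, effCornerLog L k W U' u1 z - framePotW L (k + 1) W (slicePartNL hL k hWu hx hs hWx N hθ U' u) z = jc z :=
    fun z => datum_succ hL1 k hWu hWP hx hs hWx hζs hζP hsplit0 hmean0 hh1eq z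
  -- skewness, periodicity and sizes of the junk
  have hX0s := repLog_skew hWu U' hU'u hu hgauge hX8
  have hX1s := repLog_skew hWu U' hU'u hu1 hgauge1 hX1_8
  have hgDs := gaugeDir_skew hWu hζs
  have hJs : IsSkewDir J := fun y κ => by
    rw [hJdef]; exact (skewAdjoint _).sub_mem (hX1s y κ) ((skewAdjoint _).sub_mem (hX0s y κ) (hgDs y κ))
  have hJP : IsPeriodicDir J ((tower L N (k + 1) : ℕ) : ℤ) := fun y i μ => by
    simp only [hJdef, repLog_periodic k N U' hWP hU'P huP y i μ, repLog_periodic k N U' hWP hU'P hu1P y i μ, isPeriodicDir_gaugeDir hWP hζP y i μ]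
  have hh0s := effCornerLog_skew hL k hWu hx hs hWx N U' hWP hU'u hU'P hu huP hgauge hX8 hcorner hh8 hd hα hα3 hα4 h52 hb₁0 hXb0 hsmall hc₃ hsm hαP hαP3 hαP2 hx' hU'x hx'P
  have hh1s := effCornerLog_skew hL k hWu hx hs hWx N U' hWP hU'u hU'P hu1 hu1P hgauge1 hX1_8 hcorner1 hh1_8 hd hα hα3 hα4 h52 hb₁0 hXb1 hsmall hc₃ hsm hαP hαP3 hαP2 hx' hU'x hx'P
  have hjcs : ∀ z, jc z ∈ skewAdjoint (Matrix n n ℂ) := fun z => by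
    rw [hjcdef]; exact (skewAdjoint _).sub_mem (hh1s z) ((skewAdjoint _).sub_mem (hh0s z) (hζs _))
  have hT : ((tower L N (k + 1) : ℕ) : ℤ) = ((L : ℤ) ^ (k + 1)) * (N : ℤ) := by rw [tower_eq_pow_mul]; push_cast; ring
  have hh0P := effCornerLog_periodic hL k hWu hx hs hWx N U' hWP hU'u hU'P hu huP hgauge hX8
  have hh1P := effCornerLog_periodic hL k hWu hx hs hWx N U' hWP hU'u hU'P hu1 hu1P hgauge1 hX1_8
  have hjcP : ∀ (z : Site d) (i : Fin d), jc (z + (N : ℤ) • e i) = jc z := fun z i => by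
    have e1 : ((L : ℤ) ^ (k + 1)) • (z + (N : ℤ) • e i) = ((L : ℤ) ^ (k + 1)) • z + ((tower L N (k + 1) : ℕ) : ℤ) • e i := by
      rw [smul_add, smul_smul, hT]
    simp only [hjcdef, hh0P z i, hh1P z i, e1, hζP]
  have hJle : ∀ y κ, ‖J y κ‖ ≤ (16384 * δ * s + 2048 * σ * δ + 6 * σ * s) := fun y κ => by rw [hJdef]; exact hJraw y κ
  have hjcle : ∀ z, ‖jc z‖ ≤ (4096 * σ * η + 4 * (56 * ((d : ℝ) * L) ^ 2 + 16 * (131072 * ((d : ℝ) + 1) ^ 2) * ((d : ℝ) * L)) * ((L : ℝ) ^ (k + 1)) ^ 2 * b₁ * (δ + (16384 * δ * s + 2048 * σ * δ + 6 * σ * s))) := fun z => by rw [hjcdef]; exact hjcraw z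
  -- the curl of the bond junk (the relative plaquettes are conjugated by the step)
  have hx'0 : SmallField (vary W (repLog W U' u) 1) x' := hgauge ▸ smallField_gaugeAct hu hU'x
  have hρ0 : ∀ y κ, ‖repLog W U' u y κ‖ ≤ s + δ + (16384 * δ * s + 2048 * σ * δ + 6 * σ * s) := fun y κ => (hXs y κ).trans (by linarith only [hδ0, heJ0])
  have hηJ : ∀ y κ, ‖repLog W U' u1 y κ - repLog W U' u y κ‖ ≤ δ + (16384 * δ * s + 2048 * σ * δ + 6 * σ * s) := by
    intro y κ
    have e : repLog W U' u1 y κ - repLog W U' u y κ = J y κ - gaugeDir W (gaugeFunNL hL k hWu hx hs hWx N hθ U' u) y κ := by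
      rw [hX1eq y κ]; abel
    rw [e]
    exact (norm_sub_le _ _).trans (by linarith only [hJle y κ, hδ y κ])
  have hcJ : ∀ (z : Site d) (μ ν : Fin d), μ ≠ ν → ‖curlAt W J z μ ν‖
      ≤ 2 * (2 * σ) * x' + 4 * (Real.exp (4 * (s + δ + (16384 * δ * s + 2048 * σ * δ + 6 * σ * s))) - 1) * (δ + (16384 * δ * s + 2048 * σ * δ + 6 * σ * s)) + 2 * x * σ := by
    rw [hJdef, hu1def]
    intro z μ ν hμν
    have hX1' : ∀ y κ, ‖repLog W U' (sliceStepNL hL k hWu hx hs hWx N hθ U' u) y κ‖ ≤ s + δ + (16384 * δ * s + 2048 * σ * δ + 6 * σ * s) := by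
      rw [← hu1def]; exact hX1
    have hηJ' : ∀ y κ, ‖repLog W U' (sliceStepNL hL k hWu hx hs hWx N hθ U' u) y κ - repLog W U' u y κ‖ ≤ δ + (16384 * δ * s + 2048 * σ * δ + 6 * σ * s) := by
      rw [← hu1def]; exact hηJ
    exact sup_curl_step_residue_le hWu hWx hgauge hx'0 hζs hσ hσ4 (fun y κ => (hXs y κ).trans hs4) hρ0 hX1' hηJ' z hμν
  -- the split of the next tangent part, sized
  obtain ⟨ζE, Yt1, hζEs, hζEP, hYt1, hsplitE, hmeanE, hmE, -, hδE, -⟩ :=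
    one_step_split_sized hL k hWu hWP hx hs hWx hθ hφ0.1 hφ1.1 hφ0.2 hφ1.2 hd0 hθP hK hKε hLet hε hA hY0 hJs hJP hjcs hjcP hdφ hdat
      heJ0 hec0 heE0 hcE0 hJle hcJ hjcle heE hcE
  -- `T̃(u¹) = Ỹ⁰ + (J + (Rφ̃⁰ − Rφ̃¹))`
  have hT1 : ∀ y μ, tangentPartNL hL k hWu hx hs hWx N hθ U' u1 y μ
      = slicePartNL hL k hWu hx hs hWx N hθ U' u y μ + (J y μ + (rightInvW hL k hWu hx hs hWx N hθ hφ0.1 y μ - rightInvW hL k hWu hx hs hWx N hθ hφ1.1 y μ)) := by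
    intro y μ
    have h0 := hsplit0 y μ
    simp only [tangentPartNL, normalPartNL_eq hL k hWu hx hs hWx N hθ U' hφ0.1] at h0
    simp only [tangentPartNL, normalPartNL_eq hL k hWu hx hs hWx N hθ U' hφ1.1]
    have e0 : repLog W U' u y μ = slicePartNL hL k hWu hx hs hWx N hθ U' u y μ + gaugeDir W (gaugeFunNL hL k hWu hx hs hWx N hθ U' u) y μ
        + rightInvW hL k hWu hx hs hWx N hθ hφ0.1 y μ := by rw [← h0]; abel
    rw [hX1eq y μ, e0]
    abel
  have hT1fun : (fun y μ => slicePartNL hL k hWu hx hs hWx N hθ U' u y μ + (J y μ + (rightInvW hL k hWu hx hs hWx N hθ hφ0.1 y μ - rightInvW hL k hWu hx hs hWx N hθ hφ1.1 y μ)))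
      = tangentPartNL hL k hWu hx hs hWx N hθ U' u1 := funext fun y => funext fun μ => (hT1 y μ).symm
  -- uniqueness of the normalised split: the chosen `ζ̃(u¹)` has the same `gaugeDir` as `ζ_E`
  have huniq := slice_split_unique k hWP (T := tangentPartNL hL k hWu hx hs hWx N hθ U' u1)
    hYt1 hY1 hζEs hζEP hζ1s hζ1P (fun y μ => (hT1 y μ).trans (hsplitE y μ)) hsplit1
    (funext fun z => by rw [hmeanE z, hmean1 z, hT1fun])
  have hgD1 : ∀ y μ, ‖gaugeDir W (gaugeFunNL hL k hWu hx hs hWx N hθ U' u1) y μ‖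
      ≤ eE + (2 * K * (L : ℝ) ^ (k + 1) * cE + 8 * K * (((L : ℝ) ^ (k + 1)) ^ 2 * x) * (frameC d L * (L : ℝ) ^ (k + 1) * eE + (4096 * σ * η + 4 * (56 * ((d : ℝ) * L) ^ 2 + 16 * (131072 * ((d : ℝ) + 1) ^ 2) * ((d : ℝ) * L)) * ((L : ℝ) ^ (k + 1)) ^ 2 * b₁ * (δ + (16384 * δ * s + 2048 * σ * δ + 6 * σ * s)))) / (L : ℝ) ^ (k + 1)
          + 16 * K * d * (((L : ℝ) ^ (k + 1)) ^ 2 * x) * eE) := fun y μ => by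
    rw [← huniq.2 y μ]; exact hδE y μ
  have hm1 : ∀ z, ‖framePotW L (k + 1) W (tangentPartNL hL k hWu hx hs hWx N hθ U' u1) z - effCornerLog L k W U' u1 z‖
      ≤ frameC d L * (L : ℝ) ^ (k + 1) * eE + (4096 * σ * η + 4 * (56 * ((d : ℝ) * L) ^ 2 + 16 * (131072 * ((d : ℝ) + 1) ^ 2) * ((d : ℝ) * L)) * ((L : ℝ) ^ (k + 1)) ^ 2 * b₁ * (δ + (16384 * δ * s + 2048 * σ * δ + 6 * σ * s))) := fun z => by
    rw [← hT1fun]; exact hmE z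
  -- read off the defect
  have hsE0 : 0 ≤ eE + (2 * K * (L : ℝ) ^ (k + 1) * cE + 8 * K * (((L : ℝ) ^ (k + 1)) ^ 2 * x) * (frameC d L * (L : ℝ) ^ (k + 1) * eE + (4096 * σ * η + 4 * (56 * ((d : ℝ) * L) ^ 2 + 16 * (131072 * ((d : ℝ) + 1) ^ 2) * ((d : ℝ) * L)) * ((L : ℝ) ^ (k + 1)) ^ 2 * b₁ * (δ + (16384 * δ * s + 2048 * σ * δ + 6 * σ * s)))) / (L : ℝ) ^ (k + 1)
      + 16 * K * d * (((L : ℝ) ^ (k + 1)) ^ 2 * x) * eE) := by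
    have hfC : 0 ≤ frameC d L := by unfold frameC; positivity
    positivity
  unfold sliceDefectNL frameMismatchNL
  exact add_le_add (bondSup_le hP1 hsE0 hgD1) (div_le_div_of_nonneg_right (siteSup_le hN1 hm1) hM.le)

end Step

end
end Summit.QuantumFields.BalabanUV.T4Continuum.NE7SliceIterationStepNL
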